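import Summits.QuantumFields.YangMills.Theorems.HyperbolicRegulatorCurvatureUniformityRChartDefs

/-!
# Line `single-chart-markov` (payload slug `Sketch`) — crux `CurvatureUniformityR` (stmt-QuantumFields-18154),
# route `HyperbolicRegulator` — lead skeleton v2

Lead prover `prover-line-stmt-QuantumFields-18154-0`, 2026-08-17; card `Cruxes/CurvatureUniformityR/Ideas/single-chart-markov.md`
(crux-ideate r1 k2), k1 twin `Ideate1Sketch.lean`. The crux is reached through the LANDED cut
`curvatureUniformityR_of_local_far : CurvatureUniformityLocalR → CurvatureUniformityFarR → CurvatureUniformityR`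
(`Theorems/HyperbolicRegulatorCurvatureUniformityRLocalFar.lean`, p172475), and LOCAL through the single-chart Markov line:

  stub_chartInterior        : ChartInteriorStructure                                        — G-free chart combinatorics (E0 ids injective, E1 edges at interior chart vertices, E2 squares through interior chart edges); provable now (M/L)
  stub_sumMatch             : ChartInteriorStructure → PlaquetteSumMatch                    — host action vs `ℤ⁴` plaquette sum under resampling host links (three square sorts ↔ planes 01/23/mixed, trace invariances); provable now (L)
  stub_transfer             : ChartInteriorStructure → ChartTransfer                        — resampling host links = gluing fresh `ℤ⁴` links in law (host map injective on the box, Haar inversion-invariant); provable now (M)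
  stub_chartDLR             : PlaquetteSumMatch → ChartTransfer → ChartDLR                  — the DLR identity on a flat chart box with far factor, via `integral_exp_mul_eq_integral_exp_mul_condAvg` + `integral_ymSpecification` (torus twin: `integral_torusLift_mul_eq_integral_ymSpecification_mul_of_measurable`); provable now (M/L)
  stub_localOfMeanInfluence : ChartDLR → FamilyMeanInfluenceDecay → CurvatureUniformityLocalR — covariance duality `|X(fP·H) − X(fP)X(H)| ≤ ‖H‖ X|γ_Λ f∘P − X(fP)|` + chart-distance disjointness + constants (trivial regime below `4(r_A+r_B+2)`, rate `m/4`); provable now (L); prove the RHS of `curvatureUniformityLocalR_iff`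
  stub_meanInfluence        : FamilyMeanInfluenceDecay                                      — the K-type leaf (weak-coupling mixing in MEAN currency on the family; contains Chatterjee Problem 5.1; false for U(1)); HARDEST, open
  stub_far                  : CurvatureUniformityFarR                                       — the unconsumed far regime; believed FALSE on the typed (wild) family class (periscope films); disprover target
  CurvatureUniformityR_of   : the crux BY NAME from the stubs BY NAME.

Vocabulary: `Theorems/HyperbolicRegulatorCurvatureUniformityRChartDefs.lean` (p172959, landed): `AdmR`, `IsFlatR`, `PE`, `linkVal`, `plaqWeight`,
`act`, `haarPi`, `gibbsX`, `chartRead`/`hostEdge`, `boxEdges4`, `hostSet`, the five propositions, `ClustLocalR`/`ClustFarR` and the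
unfoldings `curvatureUniformityLocalR_iff` / `curvatureUniformityFarR_iff` (`Iff.rfl`).
-/

set_option autoImplicit false

noncomputable section

namespace Summit.QuantumFields.YangMills.Cruxes.CurvatureUniformityR.SingleChartMarkov

/-! ## Registered stubs (the ONLY `sorry`s of this file) and the composition -/

/-- **stub_chartInterior** — G-free chart combinatorics of an admissible complex (E0/E1/E2). -/
theorem stub_chartInterior : ChartInteriorStructure := by
  sorry

/-- **stub_sumMatch** — resampling host links changes Wilson's action on `S × S` exactly as the `ℤ⁴` plaquette sum over
`plaquettesTouching Λ` read through the chart. -/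
theorem stub_sumMatch : ChartInteriorStructure → PlaquetteSumMatch := by
  sorry

/-- **stub_transfer** — resampling host links = gluing fresh `ℤ⁴` links, in law, on functions of the box links. -/
theorem stub_transfer : ChartInteriorStructure → ChartTransfer := by
  sorry

/-- **stub_chartDLR** — the DLR identity of the family's Wilson state on a flat chart box, far factor included. -/
theorem stub_chartDLR : PlaquetteSumMatch → ChartTransfer → ChartDLR := by
  sorry

/-- **stub_localOfMeanInfluence** — LOCAL from ChartDLR and the K-type leaf (covariance duality, chart-distance disjointness,
k-free constants). -/
theorem stub_localOfMeanInfluence : ChartDLR → FamilyMeanInfluenceDecay → CurvatureUniformityLocalR := by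
  sorry

/-- **stub_meanInfluence** — the K-type leaf: family mean influence decay at weak coupling (HARDEST; open). -/
theorem stub_meanInfluence : FamilyMeanInfluenceDecay := by
  sorry

/-- **stub_far** — FAR (unconsumed far regime; believed false on wild families; disprover target). -/
theorem stub_far : CurvatureUniformityFarR := by
  sorry

/-- **Composition** — the crux BY NAME from the stubs BY NAME, through the landed LOCAL/FAR glue. -/
theorem CurvatureUniformityR_of : Summit.QuantumFields.YangMills.Theses.HyperbolicRegulator.CurvatureUniformityR :=
  curvatureUniformityR_of_local_far
    (stub_localOfMeanInfluence
      (stub_chartDLR (stub_sumMatch stub_chartInterior) (stub_transfer stub_chartInterior)) stub_meanInfluence)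
    stub_far

end Summit.QuantumFields.YangMills.Cruxes.CurvatureUniformityR.SingleChartMarkov

end
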